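import Mathlib.RingTheory.DedekindDomain.Dvr
import Mathlib.RingTheory.DedekindDomain.Ideal.Lemmas
import Mathlib.RingTheory.LocalRing.ResidueField.Ideal
import Mathlib.RingTheory.UniqueFactorizationDomain.Multiplicity
import Mathlib.RingTheory.DiscreteValuationRing.Basic
import HarnessLib

/-!
# Block idempotents at a prime of a Dedekind domain, and the local ring at that prime

Topic `Literature/RingTheory/DedekindDomain`; namespace `Literature.RingTheory.DedekindDomain`.  THEOREMS ONLY (no definition, no named fact, no
instance, no notation, no `sorry`); Mathlib-only imports.  Cell `hodgecm-mathlib` (D-0151), FLOOR 0, P6 «MOD programme» (crux hLiu418 =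
stmt-HodgeConjecture-24832, `--supports`): organ **(O-CRT) «BLOCK IDEMPOTENTS AND THE LOCAL RING AT `w`»** of the K∕BT desk's cut v2.1 «THE
`w`-BLOCK WITHOUT COMPLETIONS» (desk F0P6d-plan (g2), 2026-09-01): the commutative algebra that splits the `p`-divisible group `A[p^∞] = ∏_{w ∣ p} A[w^∞]`
of an abelian variety with `𝒪_F`-multiplication WITHOUT `p`-adic completions — for `R` a Dedekind domain (the use: `R = 𝒪_F`), `w` a nonzero prime and
`x ∈ w` nonzero (the use: `x = p`): (§1) `x R = w^e · 𝔟` with `𝔟` prime to `w`, `e ≥ 1`, and `w^{en} ∩ 𝔟^n = x^n R`; (§2) a CRT family `a_n ≡ 1 (w^{en})`,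
`a_n ≡ 0 (𝔟^n)` — compatible (`a_{n+1} ≡ a_n`), idempotent (`a_n² ≡ a_n`) and absorbing (`w^{en}·a_n ≡ 0`, `𝔟^n·(1 − a_n) ≡ 0`) modulo `x^n`, i.e. the
layer-`n` idempotent cutting the `w`-block out of the `x^n`-torsion; (§3) elements `s ∉ w` become invertible on the block (`u_n s ≡ a_n (x^n)`, compatibly);
(§4) the local ring `R_w = Localization.AtPrime w` carries the DVR data the block numerics consume: a uniformiser `ϖ` with `ϖ^e ∼ x`, finite residue field
`≃ R ⧸ w`, and `R → R_w → κ(R_w)` surjective.  HC_CM is proved only modulo the printed citations until rung 0 closes; this file is generic and changes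
no count.

THE PRINT.  [Neukirch1999] Ch. I §3 (Chinese remainder theorem (3.6); unique factorisation of ideals (3.3)) and §11 (the localisation of a Dedekind
domain at a nonzero prime is a discrete valuation ring, (11.5)); [SerreLocalFields1979] Ch. I §3; the use is [RapoportSmithlingZhang2020Diagonal] §4.1 (p. 17)
«`A[p^∞] = ∏_w A[w^∞]`» (the idempotents of `𝒪_F ⊗ ℤ_p = ∏_{w∣p} 𝒪_{F,w}`, here produced integrally, level by level).

* §1 `exists_eq_pow_mul_coprime`, `pow_sup_pow_eq_top`, `pow_inf_pow_eq_span_pow`.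
* §2 `exists_blockIdempotentFamily`; for any such family: `sub_mem_span_pow` (compatibility), `mul_self_sub_mem_span_pow` (idempotency),
  `mul_mem_span_pow_of_mem_pow`, `mul_one_sub_mem_span_pow_of_mem_pow` (absorption).
* §3 `exists_inverseFamily`.
* §4 (`R_w := Localization.AtPrime w`) `map_eq_top_of_sup_eq_top`, `exists_irreducible_associated_pow` (+ (t1) `associated_pow_natCast` at `x = p`),
  `natCard_residueField_localizationAtPrime` (+ (t2) `…_eq_pow`), `residue_algebraMap_localizationAtPrime_surjective`, `finite_residueField_localizationAtPrime`
  (Mathlib's instance `Finite w.ResidueField` read on the kit's type).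

## References
* [Neukirch1999] J. Neukirch, *Algebraic Number Theory* (1999), Ch. I §3 ((3.3), (3.6)) and §11 ((11.5)).
* [SerreLocalFields1979] J.-P. Serre, *Local Fields*, GTM 67 (1979), Ch. I §3.
* [RapoportSmithlingZhang2020Diagonal] M. Rapoport, B. Smithling, W. Zhang, *Arithmetic diagonal cycles on unitary Shimura varieties*, Compos. Math.
  156 (2020), §4.1 (p. 17).
-/

set_option autoImplicit false

namespace Literature.RingTheory.DedekindDomain

open IsLocalRing

/-! ## §1 `x R = w^e · 𝔟` with `𝔟` prime to `w` -/

section Split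

variable {R : Type*} [CommRing R]

/-- **`x R = w^e · 𝔟`, `𝔟` PRIME TO `w`, `e ≥ 1`** for a nonzero element `x` of a nonzero prime `w` of a Dedekind domain: the `w`-primary part of the
factorisation of `(x)` (maximal power of `w` dividing `(x)`, Mathlib `WfDvdMonoid.max_power_factor'`; the cofactor is not divisible by `w`, hence
coprime to the maximal ideal `w`). [cite: Neukirch1999, Ch. I §3 (3.3)] -/
theorem exists_eq_pow_mul_coprime [IsDedekindDomain R] {w : Ideal R} (hw : w.IsPrime) (hw0 : w ≠ ⊥) {x : R} (hx0 : x ≠ 0) (hxw : x ∈ w) :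
    ∃ (e : ℕ) (𝔟 : Ideal R), 0 < e ∧ Ideal.span {x} = w ^ e * 𝔟 ∧ w ⊔ 𝔟 = ⊤ := by
  have hwmax : w.IsMaximal := hw.isMaximal hw0
  have hsx : Ideal.span {x} ≠ 0 := by
    rw [Ne, Ideal.zero_eq_bot, Ideal.span_singleton_eq_bot]; exact hx0
  have hwu : ¬IsUnit w := by rw [Ideal.isUnit_iff]; exact hwmax.ne_top
  obtain ⟨e, 𝔟, hndvd, he⟩ := WfDvdMonoid.max_power_factor' hsx hwu
  have hcop : w ⊔ 𝔟 = ⊤ := by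
    by_contra h
    apply hndvd
    rw [Ideal.dvd_iff_le, hwmax.eq_of_le h le_sup_left]
    exact le_sup_right
  refine ⟨e, 𝔟, Nat.pos_of_ne_zero ?_, he, hcop⟩
  rintro rfl
  apply hndvd
  rw [pow_zero, one_mul] at he
  rw [← he, Ideal.dvd_span_singleton]
  exact hxw

/-- Powers of coprime ideals are coprime: `w ⊔ 𝔟 = ⊤ ⟹ w^m ⊔ 𝔟^n = ⊤`. [cite: Neukirch1999, Ch. I §3 (3.6)] -/
theorem pow_sup_pow_eq_top {w 𝔟 : Ideal R} (hcop : w ⊔ 𝔟 = ⊤) (m n : ℕ) : w ^ m ⊔ 𝔟 ^ n = ⊤ :=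
  ((Ideal.isCoprime_iff_sup_eq.mpr hcop).pow (m := m) (n := n)).sup_eq

/-- **`w^{en} ∩ 𝔟^n = x^n R`** when `x R = w^e · 𝔟` with `w`, `𝔟` coprime (coprime ideals: `∩ = ·`). [cite: Neukirch1999, Ch. I §3 (3.6)] -/
theorem pow_inf_pow_eq_span_pow {w 𝔟 : Ideal R} {x : R} {e : ℕ} (hx : Ideal.span {x} = w ^ e * 𝔟) (hcop : w ⊔ 𝔟 = ⊤) (n : ℕ) :
    w ^ (e * n) ⊓ 𝔟 ^ n = Ideal.span {x ^ n} := by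
  rw [← Ideal.mul_eq_inf_of_coprime (pow_sup_pow_eq_top hcop _ _), pow_mul, ← mul_pow, ← hx, Ideal.span_singleton_pow]

end Split

/-! ## §2 The block idempotents `a_n ≡ 1 (w^{en})`, `a_n ≡ 0 (𝔟^n)` -/

section Idempotents

variable {R : Type*} [CommRing R] {w 𝔟 : Ideal R} {x : R} {e : ℕ}

/-- **THE BLOCK IDEMPOTENT FAMILY**: for coprime ideals `w`, `𝔟` and every `e` there are `a_n ∈ R` with `a_n ≡ 1 mod w^{en}` and `a_n ≡ 0 mod 𝔟^n`
(Chinese remainder theorem for the coprime pair `w^{en}`, `𝔟^n`: write `1 = y + z` and take `a_n := z`). [cite: Neukirch1999, Ch. I §3 (3.6)] -/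
theorem exists_blockIdempotentFamily (hcop : w ⊔ 𝔟 = ⊤) (e : ℕ) :
    ∃ a : ℕ → R, (∀ n, a n - 1 ∈ w ^ (e * n)) ∧ ∀ n, a n ∈ 𝔟 ^ n := by
  have h : ∀ n : ℕ, ∃ a : R, a - 1 ∈ w ^ (e * n) ∧ a ∈ 𝔟 ^ n := fun n => by
    obtain ⟨y, hy, z, hz, hyz⟩ := Submodule.mem_sup.mp ((pow_sup_pow_eq_top hcop (e * n) n).symm ▸ Submodule.mem_top (x := (1 : R)))
    refine ⟨z, ?_, hz⟩
    have : z - 1 = -y := by rw [← hyz]; ring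
    rw [this]
    exact (w ^ (e * n)).neg_mem hy
  choose a ha using h
  exact ⟨a, fun n => (ha n).1, fun n => (ha n).2⟩

/-- **Compatibility `a_{n+1} ≡ a_n mod x^n`** of any block idempotent family (`a_{n+1} − a_n ∈ w^{en} ∩ 𝔟^n = x^n R`).
[cite: Neukirch1999, Ch. I §3 (3.6)] -/
theorem sub_mem_span_pow (hx : Ideal.span {x} = w ^ e * 𝔟) (hcop : w ⊔ 𝔟 = ⊤) {a : ℕ → R} (ha1 : ∀ n, a n - 1 ∈ w ^ (e * n))
    (ha2 : ∀ n, a n ∈ 𝔟 ^ n) (n : ℕ) : a (n + 1) - a n ∈ Ideal.span {x ^ n} := by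
  rw [← pow_inf_pow_eq_span_pow hx hcop n]
  refine ⟨?_, ?_⟩
  · have h : a (n + 1) - a n = (a (n + 1) - 1) - (a n - 1) := by ring
    rw [h]
    exact sub_mem (Ideal.pow_le_pow_right (Nat.mul_le_mul_left e n.le_succ) (ha1 (n + 1))) (ha1 n)
  · exact sub_mem (Ideal.pow_le_pow_right n.le_succ (ha2 (n + 1))) (ha2 n)

/-- **Idempotency `a_n² ≡ a_n mod x^n`** (`a_n (a_n − 1) ∈ 𝔟^n · w^{en} ⊆ x^n R`). [cite: Neukirch1999, Ch. I §3 (3.6)] -/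
theorem mul_self_sub_mem_span_pow (hx : Ideal.span {x} = w ^ e * 𝔟) (hcop : w ⊔ 𝔟 = ⊤) {a : ℕ → R} (ha1 : ∀ n, a n - 1 ∈ w ^ (e * n))
    (ha2 : ∀ n, a n ∈ 𝔟 ^ n) (n : ℕ) : a n * a n - a n ∈ Ideal.span {x ^ n} := by
  rw [← pow_inf_pow_eq_span_pow hx hcop n]
  have h : a n * a n - a n = a n * (a n - 1) := by ring
  rw [h]
  exact ⟨Ideal.mul_mem_left _ _ (ha1 n), Ideal.mul_mem_right _ _ (ha2 n)⟩

/-- **Absorption: `w^{en} · a_n ≡ 0 mod x^n`.** [cite: Neukirch1999, Ch. I §3 (3.6)] -/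
theorem mul_mem_span_pow_of_mem_pow (hx : Ideal.span {x} = w ^ e * 𝔟) (hcop : w ⊔ 𝔟 = ⊤) {a : ℕ → R} (ha2 : ∀ n, a n ∈ 𝔟 ^ n) (n : ℕ)
    {b : R} (hb : b ∈ w ^ (e * n)) : b * a n ∈ Ideal.span {x ^ n} := by
  rw [← pow_inf_pow_eq_span_pow hx hcop n]
  exact ⟨Ideal.mul_mem_right _ _ hb, Ideal.mul_mem_left _ _ (ha2 n)⟩

/-- **Absorption: `𝔟^n · (1 − a_n) ≡ 0 mod x^n`.** [cite: Neukirch1999, Ch. I §3 (3.6)] -/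
theorem mul_one_sub_mem_span_pow_of_mem_pow (hx : Ideal.span {x} = w ^ e * 𝔟) (hcop : w ⊔ 𝔟 = ⊤) {a : ℕ → R}
    (ha1 : ∀ n, a n - 1 ∈ w ^ (e * n)) (n : ℕ) {c : R} (hc : c ∈ 𝔟 ^ n) : c * (1 - a n) ∈ Ideal.span {x ^ n} := by
  rw [← pow_inf_pow_eq_span_pow hx hcop n]
  have h : (1 - a n) = -(a n - 1) := by ring
  refine ⟨Ideal.mul_mem_left _ _ ?_, Ideal.mul_mem_right _ _ hc⟩
  rw [h]; exact (w ^ (e * n)).neg_mem (ha1 n)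

/-! ## §3 Elements prime to `w` are invertible on the block -/

/-- **Units away from `w`**: for `s ∉ w` (`w` maximal, e.g. a nonzero prime of a Dedekind domain) there is a compatible family `u_n` with
`u_n · s ≡ a_n mod x^n` — `u_n := a_n t_n` with `t_n s ≡ 1 mod w^{en}`; compatibility because inverses modulo `w^{en}` are unique and `a_{n+1} ≡ a_n`.
[cite: Neukirch1999, Ch. I §3 (3.6)] [cite: SerreLocalFields1979, Ch. I §3] -/
theorem exists_inverseFamily (hx : Ideal.span {x} = w ^ e * 𝔟) (hcop : w ⊔ 𝔟 = ⊤) (hwmax : w.IsMaximal) {a : ℕ → R}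
    (ha1 : ∀ n, a n - 1 ∈ w ^ (e * n)) (ha2 : ∀ n, a n ∈ 𝔟 ^ n) (s : R) (hs : s ∉ w) :
    ∃ u : ℕ → R, (∀ n, u (n + 1) - u n ∈ Ideal.span {x ^ n}) ∧ ∀ n, u n * s - a n ∈ Ideal.span {x ^ n} := by
  -- `s` is invertible modulo every `w^{en}`
  have hsw : Ideal.span {s} ⊔ w = ⊤ := by
    by_contra h
    exact hs ((hwmax.eq_of_le h le_sup_right).symm ▸ Ideal.mem_sup_left (Ideal.mem_span_singleton_self s))
  have ht : ∀ n : ℕ, ∃ t : R, t * s - 1 ∈ w ^ (e * n) := fun n => by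
    have htop : Ideal.span {s} ⊔ w ^ (e * n) = ⊤ := by
      simpa only [pow_one] using pow_sup_pow_eq_top hsw 1 (e * n)
    obtain ⟨y, hy, z, hz, hyz⟩ := Submodule.mem_sup.mp (htop.symm ▸ Submodule.mem_top (x := (1 : R)))
    obtain ⟨t, rfl⟩ := Ideal.mem_span_singleton'.mp hy
    refine ⟨t, ?_⟩
    have : t * s - 1 = -z := by rw [← hyz]; ring
    rw [this]; exact (w ^ (e * n)).neg_mem hz
  choose t ht using ht
  refine ⟨fun n => a n * t n, fun n => ?_, fun n => ?_⟩
  · -- compatibility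
    rw [← pow_inf_pow_eq_span_pow hx hcop n]
    refine ⟨?_, ?_⟩
    · have h : a (n + 1) * t (n + 1) - a n * t n =
          (a (n + 1) - 1) * t (n + 1) + (t (n + 1) * -(t n * s - 1) + (t (n + 1) * s - 1) * t n) - (a n - 1) * t n := by ring
      rw [h]
      have hle : w ^ (e * (n + 1)) ≤ w ^ (e * n) := Ideal.pow_le_pow_right (Nat.mul_le_mul_left e n.le_succ)
      refine sub_mem (add_mem (Ideal.mul_mem_right _ _ (hle (ha1 (n + 1)))) (add_mem ?_ ?_)) (Ideal.mul_mem_right _ _ (ha1 n))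
      · exact Ideal.mul_mem_left _ _ ((w ^ (e * n)).neg_mem (ht n))
      · exact Ideal.mul_mem_right _ _ (hle (ht (n + 1)))
    · exact sub_mem (Ideal.mul_mem_right _ _ (Ideal.pow_le_pow_right n.le_succ (ha2 (n + 1)))) (Ideal.mul_mem_right _ _ (ha2 n))
  · -- `u_n s - a_n = a_n (t_n s - 1)`
    rw [← pow_inf_pow_eq_span_pow hx hcop n]
    have h : a n * t n * s - a n = a n * (t n * s - 1) := by ring
    rw [h]
    exact ⟨Ideal.mul_mem_left _ _ (ht n), Ideal.mul_mem_right _ _ (ha2 n)⟩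

end Idempotents

/-! ## §4 The local ring `R_w = Localization.AtPrime w`: uniformiser, residue field, surjectivity -/

section Local

variable {R : Type*} [CommRing R] (w : Ideal R) [hw : w.IsPrime]

/-- An ideal coprime to `w` becomes the unit ideal in `R_w` (it contains an element outside `w`, which is a unit of `R_w`).
[cite: Neukirch1999, Ch. I §11 (11.5)] -/
theorem map_eq_top_of_sup_eq_top {𝔟 : Ideal R} (hcop : w ⊔ 𝔟 = ⊤) :
    𝔟.map (algebraMap R (Localization.AtPrime w)) = ⊤ := by
  have h𝔟 : ¬𝔟 ≤ w := fun hle => hw.ne_top (top_le_iff.mp (hcop ▸ sup_le le_rfl hle))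
  obtain ⟨b, hb, hbw⟩ := Set.not_subset.mp h𝔟
  exact Ideal.eq_top_of_isUnit_mem _ (Ideal.mem_map_of_mem _ hb)
    ((IsLocalization.AtPrime.isUnit_to_map_iff (Localization.AtPrime w) w b).mpr hbw)

/-- **The uniformiser: `ϖ^e ∼ x` in `R_w`** when `x R = w^e · 𝔟` with `𝔟` prime to `w`, `R` a Dedekind domain and `w ≠ 0` (`R_w` is a discrete valuation
ring, Mathlib `IsLocalization.AtPrime.isDiscreteValuationRing_of_dedekind_domain`; `w R_w = (ϖ)`, `𝔟 R_w = R_w`, so `x R_w = (ϖ^e)`).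
[cite: Neukirch1999, Ch. I §11 (11.5)] [cite: SerreLocalFields1979, Ch. I §3] -/
theorem exists_irreducible_associated_pow [IsDedekindDomain R] (hw0 : w ≠ ⊥) {𝔟 : Ideal R} {x : R} {e : ℕ}
    (hx : Ideal.span {x} = w ^ e * 𝔟) (hcop : w ⊔ 𝔟 = ⊤) :
    ∃ ϖ : Localization.AtPrime w, Irreducible ϖ ∧ Associated (ϖ ^ e) (algebraMap R (Localization.AtPrime w) x) := by
  haveI : IsDiscreteValuationRing (Localization.AtPrime w) :=
    IsLocalization.AtPrime.isDiscreteValuationRing_of_dedekind_domain R hw0 _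
  obtain ⟨ϖ, hϖ⟩ := IsDiscreteValuationRing.exists_irreducible (Localization.AtPrime w)
  refine ⟨ϖ, hϖ, ?_⟩
  rw [← Ideal.span_singleton_eq_span_singleton, ← Ideal.span_singleton_pow, ← hϖ.maximalIdeal_eq, ← Localization.AtPrime.map_eq_maximalIdeal,
    ← Ideal.map_pow, ← Set.image_singleton, ← Ideal.map_span, hx, Ideal.map_mul, map_eq_top_of_sup_eq_top w hcop, Ideal.mul_top]

/-- (t1) **`ϖ^e ∼ p` in `R_w`** — the previous theorem at `x = p` a rational prime (`p R = w^e · 𝔟`, `e` the ramification index of `w`), with the target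
spelled as the numeral `(p : R_w)` (the kit's `hpe : Associated (ϖ ^ e) (p : 𝒪)`). [cite: Neukirch1999, Ch. I §11 (11.5)] [cite: SerreLocalFields1979, Ch. I §3] -/
theorem associated_pow_natCast [IsDedekindDomain R] (hw0 : w ≠ ⊥) (p : ℕ) {𝔟 : Ideal R} {e : ℕ}
    (hx : Ideal.span {(p : R)} = w ^ e * 𝔟) (hcop : w ⊔ 𝔟 = ⊤) :
    ∃ ϖ : Localization.AtPrime w, Irreducible ϖ ∧ Associated (ϖ ^ e) (p : Localization.AtPrime w) := by
  simpa only [map_natCast] using exists_irreducible_associated_pow w hw0 hx hcop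

/-- **The residue field of `R_w` is `R ⧸ w`** (`w` maximal): `#κ(R_w) = #(R ⧸ w)` (Mathlib `Ideal.bijective_algebraMap_quotient_residueField`; the residue
field `IsLocalRing.ResidueField (Localization.AtPrime w)` is Mathlib's `w.ResidueField` by definition, FINITE when `R ⧸ w` is, by the instance of that name).
[cite: Neukirch1999, Ch. I §11 (11.5)] -/
theorem natCard_residueField_localizationAtPrime [w.IsMaximal] :
    Nat.card (ResidueField (Localization.AtPrime w)) = Nat.card (R ⧸ w) :=
  (Nat.card_eq_of_bijective _ (Ideal.bijective_algebraMap_quotient_residueField w)).symm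

/-- (t2) **`#κ(R_w) = p^f`** when `#(R ⧸ w) = p^f` (the kit's `hq`). [cite: Neukirch1999, Ch. I §11 (11.5)] -/
theorem natCard_residueField_localizationAtPrime_eq_pow [w.IsMaximal] {p f : ℕ} (hf : Nat.card (R ⧸ w) = p ^ f) :
    Nat.card (ResidueField (Localization.AtPrime w)) = p ^ f :=
  (natCard_residueField_localizationAtPrime w).trans hf

/-- **`R → R_w → κ(R_w)` is surjective** (`w` maximal): every residue class of the local ring is represented by an element of `R` (the block numerics'
hypothesis «`σO → 𝒪 ⧸ ϖ` surjective» with `σO := R`). [cite: Neukirch1999, Ch. I §11 (11.5)] -/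
theorem residue_algebraMap_localizationAtPrime_surjective [w.IsMaximal] :
    Function.Surjective fun r : R => residue (Localization.AtPrime w) (algebraMap R (Localization.AtPrime w) r) := by
  intro y
  obtain ⟨r, hr⟩ := Ideal.algebraMap_residueField_surjective w y
  refine ⟨r, ?_⟩
  rw [← hr, IsScalarTower.algebraMap_apply R (Localization.AtPrime w) (ResidueField (Localization.AtPrime w)), ResidueField.algebraMap_eq]

/-- Finiteness of the residue field of `R_w` from that of `R ⧸ w` — Mathlib's instance `Finite w.ResidueField` read on
`IsLocalRing.ResidueField (Localization.AtPrime w)` (the same type). [cite: Neukirch1999, Ch. I §11 (11.5)] -/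
theorem finite_residueField_localizationAtPrime [Finite (R ⧸ w)] : Finite (ResidueField (Localization.AtPrime w)) :=
  inferInstanceAs (Finite w.ResidueField)

end Local

end Literature.RingTheory.DedekindDomain
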